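import Summits.QuantumFields.BalabanUV.T4Continuum.Support.NE7EtaCurlFromCovGradient

/-!
# NE7EtaPlainGradientLetters — route #1 of the NE7 crux, stub S7 (NODE O, the BACKGROUND COORDINATE): the PLAIN bondwise distance and
# the PLAIN lattice gradient of the discrepancy `W·e^Z − W` from the covariant display (P), (Gᶜ) of `closeness_of_covRoot₂` and TWO
# smooth-gauge letters of `W` — the quantities an ambient-embedding carrier gauge reads (design constraint located for NODE O)

Cell `pub-balaban`, rung (B)+1 sub-cell t4, lineage `b2b-balaban-t4-ne7-p1`, generation 24 (CRUX PROVER NE7 #1, ruling e34b3e0c); crux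
skeleton `t4/skeletons/NE7-CRUX-R1.md` v1.7.1 §0bis item 10 (ii) «NODE O's carrier (background coordinate first)»; sequel of
`NE7EtaCurlFromCovGradient` (p254713).  HONEST FRAMING (page 1): FIXED FINITE T⁴, rung (B)+1; NE7, NE3 NOT PRINTED in
[Balaban1984PropagatorsI]–[Balaban1989LargeFieldII] and NOT PROVED here; continuum YM on T⁴ ⇐ BetaPertH ∧ nine spine estimates (0/9 proved);
BetaPertH ⇐ (D1) ∧ (D4) ∧ CAP+tail; G-an2-4 gates asym, D1 and NE2/3/4; NOT infinite volume, NOT mass gap, NOT Clay.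

LOCATED (gen 24, design level; NODE O is OWNERLESS — nothing below instantiates a carrier).
 (F1) Route 1 consumes the Lipschitz-in-the-background bracket through T.2 `TermwiseAnalyticMarginLayered.lipBackground_of_layeredMargin`,
      whose socket is a GLOBAL embedding `ι : C.BgA → E` into ONE complex normed space with `hgauge : ‖ι U − ι U'‖ ≤ C.gauge U U'` and a
      creation margin that is a BALL of `E` (`closedBall (ι U) (ϱ₀ g j) ⊆ Dch g X 0`), while its constant `8E₀∕ϱ₀ g j` must obey
      `T4TowerRateComposition.PolyLipGrowth` (no geometric growth in `j`).  The printed analyticity box is TWO-radius ((1.13) p. 262 of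
      [Balaban1987RG1], the lineage's currency census of gen 21: potential radius `α₀·ξ`, gradient radius `α₁·ξ²`, `ξ = L^{−k} = θ^{6k}`).  Hence
      `E`'s norm at level `k` must be the LEVEL-WEIGHTED max-norm of BOTH the bond values (weight `ξ⁻¹`) and their PLAIN lattice gradient
      (weight `ξ⁻²`) — a sup-only norm would force `ϱ₀ ≤ α₁ξ²∕2`, i.e. `CU ≍ L^{2j}`, and the argument bracket `CU·δ ≍ θ^{8K−12K}` diverges.
      Consequently a bondwise-sup carrier gauge WITHOUT gradient part — the KIND of the O1-a instance `B13Carriers.carriers` (NE5 leaf-01, built for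
      NE5's sockets, which read no gauge) — cannot be route 1's `C.gauge`: `hgauge` needs a gauge dominating a PLAIN gradient.
 (F2) The covariant display of `closeness_of_covRoot₂` ((P) `‖Z‖ ≤ 8l₁²γ·θ^{8k}`, (Gᶜ) END-point covariant gradient `≤ 4l₁√(2γΛ₂′)·θ^{13k}`) bounds the
      PLAIN gradient of `W·e^Z − W` only together with two SMOOTH-GAUGE LETTERS of `W = rescale L (bavg L UB)`: `s₀ = sup_b ‖W_b − 1‖` and
      `s₁ = sup ‖W(x + e_μ, κ) − W(x, κ)‖` (this file, §1):
        `‖(W e^Z − W)(x+e_μ, κ) − (W e^Z − W)(x, κ)‖ ≤ s₁·(e^p − 1) + 2·expRem p + q + 2·s₀·p`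
      (`p` = sup‖Z‖, `q` = sup covariant gradient).  With `s₀, s₁ ≤ σ·θ^{6k}` (a regular gauge of the run-B minimiser carried through one
      averaging: [Balaban1985Variational] Thm 1 (9)–(10) p. 279 ∕ [Balaban1985Averaging] §2 TYPE — a ONE-RUN binder, NOT in the tree, asserted
      nowhere here) every term is `≤ const·θ^{13k}` against the gradient margin `θ^{12k}`, and the plain bond distance is `≤ 16l₁²γ·θ^{8k}` against
      `θ^{6k}`: the (1.13) field-unit reading of the pair is `≤ C_O·θ^k`, `C_O = 16l₁²γ + 4l₁√(2γΛ₂′) + 16l₁²γ(σ₀ + σ₁) + 128l₁⁴γ²` (§2) — the shape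
      `δc K ≤ C₃θ₃^K` of `T4TowerRateComposition.argBracket_tower` with `θ₃ = θ = L^{−1∕6}`.  So the covariant re-typing of the ask of NE3 (gens 22–23)
      stands, and the plain quantities the embedding needs are recovered on the CONSUMER side at the price of a smooth gauge for ONE run's
      background (one-run), never for the pair.
 (F3) The selection the carrier must make is `uA K v := gaugeAct u UA` (the root's `u`), a minimiser for the datum `(u ∘ L^k•)·V`, not `V`
      (`BlockAverageCurrent.rescale_bavg_gaugeAct`, `NE3CpushGaugeCovariance.cavgIter_gaugeAct`): NODE O needs EITHER a gauge-invariance binder on run A's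
      functionals (printed TYPE, [Balaban1987RG1] §1; abstract shape `T4BirthChartTransport.GaugeInvariant`) OR a datum-preserving root (`u = 1` on
      `L^kℤ⁴`).  Recorded, not typed (0 def).
WHAT IS PROVED ([folklore]; any `d`, any `n` in §1; real bookkeeping in §2; `d = 4` in §3): `val_vary_one`, `norm_plainSup_le` (bond distance
`≤ e^p − 1`), `norm_plainDiff_dir_le` (plain difference of `Z` ≤ covariant one `+ 2s₀p`), `norm_exp_sub_exp_le_letters`, **`norm_plainGrad_le`** (the
display of (F2)), **`letters_at_rates`** (§2: `≤ 2a·θ^{8k}` and `≤ (c + 2a(σ₀+σ₁) + 2a²)·θ^{13k}`), **`plain_reading_le`**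
((1.13) field-unit reading `≤ C_O θ^k`), **`plain_letters_of_rates`** and **`plain_closeness_of_covRoot₂`** (§3: the END `closeness_of_covRoot₂` followed
by §§1–2, smooth-gauge letters of the given `W` as displayed hypotheses).  HONEST.  Algebra + bookkeeping over landed modules; the root is a
HYPOTHESIS (row NE3's unseated estimate); the smooth-gauge letters are HYPOTHESES; nothing of NE3∕NE7 discharged; NO carrier instantiated (NODE O
ownerless; the instance needs the dagwriter's convention across `LipBackground`∕NE5∕NE9); 0 def; 0 sorry; nothing printed is a hypothesis of a
theorem.
-/

set_option autoImplicit false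

open scoped BigOperators Matrix Matrix.Norms.L2Operator
open Finset NormedSpace

namespace Summit.QuantumFields.BalabanUV.T4Continuum.NE7EtaPlainGradientLetters

open Literature.MathematicalPhysics.QuantumFieldTheory.Balaban1983to89
open B7Prop1Explicit B7Prop2Explicit
open T4AveragingDeficitWall hiding Site Plane Plaq Bond
open T4AveragingDeficitWallBoundary (periodBox IsPeriodicCfg)
open AveragingDeficitPeriodicCounting (IsPeriodicDir)
open AveragingDeficitTransport (norm_Ad_of_unitary mem_U1_of_unitary)
open AveragingDeficitNearIdentity (norm_Ad_sub_le)
open MinimalActionSandwich (IsMinimiser)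
open MinimalActionRate (Regular)
open NE3EnergyShapes (residualScale IsUnitarySite IsPeriodicSite)
open NE3EnergyWeightedShapes (energyNormW)
open NE3CurlStability (norm_vary_sub_le_of_sup)
open AveragingDeficitDualResidual (dualC1 dualC2)
open AveragingDeficitDerivWallProof (wallConst)
open NE7EtaCurlFromCovGradient (closeness_of_covRoot₂)
open NE7EtaRatesD4CovReg (unitary_periodic_rescale_bavg_of_regular)

noncomputable section

variable {d : ℕ} {n : Type*} [Fintype n] [DecidableEq n]

/-! ## §1 The algebra: plain quantities from covariant ones and two letters of `W` -/

/-- `(W e^Z)(b) = W(b)·e^{Z(b)}` at `s = 1`. [folklore] -/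
theorem val_vary_one (W : Site d → Fin d → (Matrix n n ℂ)ˣ) (Z : Site d → Fin d → Matrix n n ℂ) (y : Site d) (ν : Fin d) :
    ((vary W Z 1 y ν : (Matrix n n ℂ)ˣ) : Matrix n n ℂ) = (W y ν : Matrix n n ℂ) * exp (Z y ν) := by
  simp only [vary, Units.val_mul, val_expUnit, Complex.ofReal_one, one_smul]

/-- The splitting `W₁E₁ − W₁ − (W₀E₀ − W₀) = (W₁ − W₀)(E₁ − 1) + W₀(E₁ − E₀)` in any ring. [folklore] -/
private theorem split_alg {R : Type*} [Ring R] (W₁ W₀ E₁ E₀ : R) :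
    (W₁ * E₁ - W₁) - (W₀ * E₀ - W₀) = (W₁ - W₀) * (E₁ - 1) + W₀ * (E₁ - E₀) := by
  noncomm_ring

/-- **PLAIN BOND DISTANCE**: for unitary `W` and `sup ‖Z‖ ≤ p`, `‖(W e^Z)(b) − W(b)‖ ≤ e^p − 1` at every bond. [folklore] -/
theorem norm_plainSup_le [Nonempty n] {W : Site d → Fin d → (Matrix n n ℂ)ˣ} (hW : IsUnitaryCfg W)
    {Z : Site d → Fin d → Matrix n n ℂ} {p : ℝ} (hZ : ∀ x κ, ‖Z x κ‖ ≤ p) (x : Site d) (κ : Fin d) :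
    ‖((vary W Z 1 x κ : (Matrix n n ℂ)ˣ) : Matrix n n ℂ) - (W x κ : Matrix n n ℂ)‖ ≤ Real.exp p - 1 := by
  have h := norm_vary_sub_le_of_sup hW hZ 1 x κ
  simpa only [abs_one, one_mul] using h

/-- **PLAIN DIFFERENCE OF THE DIRECTION ≤ COVARIANT DIFFERENCE + `2s₀p`**: for a unitary bond variable `w` (the transporter
`W (x + e κ) μ`) and matrices `Z₁ = Z (x + e μ) κ`, `Z₀ = Z x κ` with `‖Z₁‖ ≤ p`, `‖w − 1‖ ≤ s₀`:
`‖Z₁ − Z₀‖ ≤ ‖Ad w Z₁ − Z₀‖ + 2·s₀·p`. [folklore] -/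
theorem norm_plainDiff_dir_le [Nonempty n] {w : (Matrix n n ℂ)ˣ} (hw : w ∈ unitaryUnits (Matrix n n ℂ)) {Z₁ Z₀ : Matrix n n ℂ}
    {p s₀ : ℝ} (hZ₁ : ‖Z₁‖ ≤ p) (hs₀ : ‖(w : Matrix n n ℂ) - 1‖ ≤ s₀) :
    ‖Z₁ - Z₀‖ ≤ ‖Ad w Z₁ - Z₀‖ + 2 * s₀ * p := by
  have h1 : ‖Ad w Z₁ - Z₁‖ ≤ 2 * ‖(w : Matrix n n ℂ) - 1‖ * ‖Z₁‖ := norm_Ad_sub_le hw Z₁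
  have h2 : 2 * ‖(w : Matrix n n ℂ) - 1‖ * ‖Z₁‖ ≤ 2 * s₀ * p :=
    mul_le_mul (mul_le_mul_of_nonneg_left hs₀ (by norm_num)) hZ₁ (norm_nonneg _)
      (mul_nonneg (by norm_num) ((norm_nonneg _).trans hs₀))
  have hsplit : Z₁ - Z₀ = (Ad w Z₁ - Z₀) - (Ad w Z₁ - Z₁) := by abel
  calc ‖Z₁ - Z₀‖ = ‖(Ad w Z₁ - Z₀) - (Ad w Z₁ - Z₁)‖ := by rw [hsplit]
    _ ≤ ‖Ad w Z₁ - Z₀‖ + ‖Ad w Z₁ - Z₁‖ := norm_sub_le _ _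
    _ ≤ ‖Ad w Z₁ - Z₀‖ + 2 * s₀ * p := by linarith

/-- **DIFFERENCE OF TWO EXPONENTIALS, SECOND-ORDER LETTERS**: `‖e^{Z₁} − e^{Z₀}‖ ≤ 2·expRem p + ‖Z₁ − Z₀‖` for `‖Z₁‖, ‖Z₀‖ ≤ p`
(`expRem p = e^p − 1 − p`; write `e^{Z₁} − e^{Z₀} = (e^{Z₁} − 1 − Z₁) − (e^{Z₀} − 1 − Z₀) + (Z₁ − Z₀)`). [folklore] -/
theorem norm_exp_sub_exp_le_letters [Nonempty n] {Z₁ Z₀ : Matrix n n ℂ} {p : ℝ} (hZ₁ : ‖Z₁‖ ≤ p) (hZ₀ : ‖Z₀‖ ≤ p) :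
    ‖exp Z₁ - exp Z₀‖ ≤ 2 * expRem p + ‖Z₁ - Z₀‖ := by
  have h1 := (norm_exp_sub_one_le_of_norm_le hZ₁).2
  have h0 := (norm_exp_sub_one_le_of_norm_le hZ₀).2
  have hsplit : exp Z₁ - exp Z₀ = (exp Z₁ - 1 - Z₁) - (exp Z₀ - 1 - Z₀) + (Z₁ - Z₀) := by abel
  calc ‖exp Z₁ - exp Z₀‖ = ‖(exp Z₁ - 1 - Z₁) - (exp Z₀ - 1 - Z₀) + (Z₁ - Z₀)‖ := by rw [hsplit]
    _ ≤ ‖(exp Z₁ - 1 - Z₁) - (exp Z₀ - 1 - Z₀)‖ + ‖Z₁ - Z₀‖ := norm_add_le _ _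
    _ ≤ ‖exp Z₁ - 1 - Z₁‖ + ‖exp Z₀ - 1 - Z₀‖ + ‖Z₁ - Z₀‖ := by gcongr; exact norm_sub_le _ _
    _ ≤ 2 * expRem p + ‖Z₁ - Z₀‖ := by linarith

/-- **THE PLAIN LATTICE GRADIENT OF THE DISCREPANCY `W e^Z − W` FROM THE COVARIANT DISPLAY AND TWO LETTERS OF `W`** ((F2) of the header).
`W` unitary with `‖W_b − 1‖ ≤ s₀` (all bonds) and `‖W(x + e_μ, κ) − W(x, κ)‖ ≤ s₁` (all `x μ κ`); `Z` with `‖Z‖ ≤ p` and END-point covariant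
gradient `‖Ad (W (x + e κ) μ) (Z (x + e μ) κ) − Z x κ‖ ≤ q`.  THEN for `B := W e^Z − W` (bondwise matrices):
`‖B(x + e_μ, κ) − B(x, κ)‖ ≤ s₁·(e^p − 1) + 2·expRem p + q + 2·s₀·p`. [folklore] -/
theorem norm_plainGrad_le [Nonempty n] {W : Site d → Fin d → (Matrix n n ℂ)ˣ} (hW : IsUnitaryCfg W)
    {Z : Site d → Fin d → Matrix n n ℂ} {p q s₀ s₁ : ℝ} (hZ : ∀ x κ, ‖Z x κ‖ ≤ p)
    (hcov : ∀ (κ : Fin d) (x : Site d) (μ : Fin d), ‖Ad (W (x + e κ) μ) (Z (x + e μ) κ) - Z x κ‖ ≤ q)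
    (hs₀ : ∀ x κ, ‖((W x κ : (Matrix n n ℂ)ˣ) : Matrix n n ℂ) - 1‖ ≤ s₀)
    (hs₁ : ∀ x μ κ, ‖((W (x + e μ) κ : (Matrix n n ℂ)ˣ) : Matrix n n ℂ) - ((W x κ : (Matrix n n ℂ)ˣ) : Matrix n n ℂ)‖ ≤ s₁)
    (x : Site d) (μ κ : Fin d) :
    ‖(((vary W Z 1 (x + e μ) κ : (Matrix n n ℂ)ˣ) : Matrix n n ℂ) - ((W (x + e μ) κ : (Matrix n n ℂ)ˣ) : Matrix n n ℂ))
        - (((vary W Z 1 x κ : (Matrix n n ℂ)ˣ) : Matrix n n ℂ) - ((W x κ : (Matrix n n ℂ)ˣ) : Matrix n n ℂ))‖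
      ≤ s₁ * (Real.exp p - 1) + 2 * expRem p + q + 2 * s₀ * p := by
  have hW₀1 : ‖((W x κ : (Matrix n n ℂ)ˣ) : Matrix n n ℂ)‖ ≤ 1 := (mem_U1_of_unitary (hW x κ)).1
  rw [val_vary_one, val_vary_one, split_alg]
  -- first term: letter `s₁` times `e^p − 1`
  have hexp1 : ‖exp (Z (x + e μ) κ) - 1‖ ≤ Real.exp p - 1 := (norm_exp_sub_one_le_of_norm_le (hZ (x + e μ) κ)).1
  have t1 : ‖(((W (x + e μ) κ : (Matrix n n ℂ)ˣ) : Matrix n n ℂ) - ((W x κ : (Matrix n n ℂ)ˣ) : Matrix n n ℂ))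
        * (exp (Z (x + e μ) κ) - 1)‖ ≤ s₁ * (Real.exp p - 1) :=
    (norm_mul_le _ _).trans (mul_le_mul (hs₁ x μ κ) hexp1 (norm_nonneg _) ((norm_nonneg _).trans (hs₁ x μ κ)))
  -- second term: `‖W₀‖ ≤ 1` times the exponential difference
  have hdiff : ‖Z (x + e μ) κ - Z x κ‖ ≤ q + 2 * s₀ * p :=
    (norm_plainDiff_dir_le (hW (x + e κ) μ) (hZ (x + e μ) κ) (hs₀ (x + e κ) μ)).trans (by linarith [hcov κ x μ])
  have t2 : ‖((W x κ : (Matrix n n ℂ)ˣ) : Matrix n n ℂ) * (exp (Z (x + e μ) κ) - exp (Z x κ))‖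
      ≤ 2 * expRem p + q + 2 * s₀ * p :=
    calc ‖((W x κ : (Matrix n n ℂ)ˣ) : Matrix n n ℂ) * (exp (Z (x + e μ) κ) - exp (Z x κ))‖
          ≤ ‖((W x κ : (Matrix n n ℂ)ˣ) : Matrix n n ℂ)‖ * ‖exp (Z (x + e μ) κ) - exp (Z x κ)‖ := norm_mul_le _ _
      _ ≤ 1 * (2 * expRem p + ‖Z (x + e μ) κ - Z x κ‖) :=
          mul_le_mul hW₀1 (norm_exp_sub_exp_le_letters (hZ (x + e μ) κ) (hZ x κ)) (norm_nonneg _) zero_le_one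
      _ ≤ 2 * expRem p + q + 2 * s₀ * p := by linarith
  calc _ ≤ ‖(((W (x + e μ) κ : (Matrix n n ℂ)ˣ) : Matrix n n ℂ) - ((W x κ : (Matrix n n ℂ)ˣ) : Matrix n n ℂ))
              * (exp (Z (x + e μ) κ) - 1)‖
          + ‖((W x κ : (Matrix n n ℂ)ˣ) : Matrix n n ℂ) * (exp (Z (x + e μ) κ) - exp (Z x κ))‖ := norm_add_le _ _
    _ ≤ s₁ * (Real.exp p - 1) + (2 * expRem p + q + 2 * s₀ * p) := add_le_add t1 t2
    _ = s₁ * (Real.exp p - 1) + 2 * expRem p + q + 2 * s₀ * p := by ring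

/-! ## §2 Real bookkeeping: the letters at the rates of the display (`ξ = θ^{6k}`) -/

/-- **THE LETTERS AT RATE** (real bookkeeping).  With `p = a·θ^{8k} ≤ 1` ((P), `a = 8l₁²γ`), `q = c·θ^{13k}` ((Gᶜ), `c = 4l₁√(2γΛ₂′)`), smooth-gauge
letters `σ₀θ^{6k}`, `σ₁θ^{6k}`, `0 < θ ≤ 1`: a bond distance `D ≤ e^p − 1` is `≤ 2a·θ^{8k}`, and a plain gradient
`G ≤ σ₁θ^{6k}(e^p − 1) + 2·expRem p + q + 2σ₀θ^{6k}·p` is `≤ (c + 2a(σ₀ + σ₁) + 2a²)·θ^{13k}`. [folklore] -/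
theorem letters_at_rates {θ a c σ₀ σ₁ p q D G : ℝ} {k : ℕ} (hθ : 0 < θ) (hθ1 : θ ≤ 1) (ha : 0 ≤ a) (hσ₀ : 0 ≤ σ₀)
    (hσ₁ : 0 ≤ σ₁) (hp : p = a * θ ^ (8 * k)) (hp1 : p ≤ 1) (hq : q = c * θ ^ (13 * k))
    (hD : D ≤ Real.exp p - 1)
    (hG : G ≤ σ₁ * θ ^ (6 * k) * (Real.exp p - 1) + 2 * expRem p + q + 2 * (σ₀ * θ ^ (6 * k)) * p) :
    D ≤ 2 * a * θ ^ (8 * k) ∧ G ≤ (c + 2 * a * (σ₀ + σ₁) + 2 * a ^ 2) * θ ^ (13 * k) := by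
  have hθk : ∀ m : ℕ, 0 ≤ θ ^ m := fun m => pow_nonneg hθ.le m
  have hθle : ∀ {i j : ℕ}, j ≤ i → θ ^ i ≤ θ ^ j := fun h => pow_le_pow_of_le_one hθ.le hθ1 h
  have hp0 : 0 ≤ p := by rw [hp]; exact mul_nonneg ha (hθk _)
  have hrem : expRem p ≤ p ^ 2 := expRem_le_sq hp0 hp1
  -- `e^p − 1 = expRem p + p ≤ p² + p ≤ 2p` (`p ≤ 1`)
  have hexp : Real.exp p - 1 ≤ 2 * p := by
    have hp2 : p ^ 2 ≤ p := by nlinarith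
    have h := hrem
    unfold expRem at h
    linarith
  have e14 : θ ^ (6 * k) * θ ^ (8 * k) = θ ^ (14 * k) := by rw [← pow_add]; congr 1; ring
  have e16 : θ ^ (8 * k) * θ ^ (8 * k) = θ ^ (16 * k) := by rw [← pow_add]; congr 1; ring
  have h14 : θ ^ (14 * k) ≤ θ ^ (13 * k) := hθle (by omega)
  have h16 : θ ^ (16 * k) ≤ θ ^ (13 * k) := hθle (by omega)
  refine ⟨?_, ?_⟩
  · calc D ≤ Real.exp p - 1 := hD
      _ ≤ 2 * p := hexp
      _ = 2 * a * θ ^ (8 * k) := by rw [hp]; ring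
  have t1 : σ₁ * θ ^ (6 * k) * (Real.exp p - 1) ≤ 2 * a * σ₁ * θ ^ (13 * k) := by
    calc σ₁ * θ ^ (6 * k) * (Real.exp p - 1) ≤ σ₁ * θ ^ (6 * k) * (2 * p) :=
          mul_le_mul_of_nonneg_left hexp (mul_nonneg hσ₁ (hθk _))
      _ = 2 * a * σ₁ * (θ ^ (6 * k) * θ ^ (8 * k)) := by rw [hp]; ring
      _ ≤ 2 * a * σ₁ * θ ^ (13 * k) := by
          rw [e14]; exact mul_le_mul_of_nonneg_left h14 (by positivity)
  have t2 : 2 * expRem p ≤ 2 * a ^ 2 * θ ^ (13 * k) := by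
    calc 2 * expRem p ≤ 2 * p ^ 2 := by linarith
      _ = 2 * a ^ 2 * (θ ^ (8 * k) * θ ^ (8 * k)) := by rw [hp]; ring
      _ ≤ 2 * a ^ 2 * θ ^ (13 * k) := by
          rw [e16]; exact mul_le_mul_of_nonneg_left h16 (by positivity)
  have t4 : 2 * (σ₀ * θ ^ (6 * k)) * p ≤ 2 * a * σ₀ * θ ^ (13 * k) := by
    calc 2 * (σ₀ * θ ^ (6 * k)) * p = 2 * a * σ₀ * (θ ^ (6 * k) * θ ^ (8 * k)) := by rw [hp]; ring
      _ ≤ 2 * a * σ₀ * θ ^ (13 * k) := by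
          rw [e14]; exact mul_le_mul_of_nonneg_left h14 (by positivity)
  calc G ≤ σ₁ * θ ^ (6 * k) * (Real.exp p - 1) + 2 * expRem p + q + 2 * (σ₀ * θ ^ (6 * k)) * p := hG
    _ ≤ 2 * a * σ₁ * θ ^ (13 * k) + 2 * a ^ 2 * θ ^ (13 * k) + c * θ ^ (13 * k) + 2 * a * σ₀ * θ ^ (13 * k) := by
          rw [hq] at *; linarith
    _ = (c + 2 * a * (σ₀ + σ₁) + 2 * a ^ 2) * θ ^ (13 * k) := by ring

/-- **THE (1.13) FIELD-UNIT READING OF THE PAIR IS GEOMETRIC**: a bond distance `D ≤ A·θ^{8k}` read in potential units `ξ = θ^{6k}` and a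
plain gradient `G ≤ C_G·θ^{13k}` read in gradient units `ξ² = θ^{12k}` are both `≤ (A + C_G)·θ^k` (`0 < θ ≤ 1`, `A, C_G ≥ 0`) — the shape
`δc K ≤ C₃·θ₃^K` the argument bracket `T4TowerRateComposition.argBracket_tower` consumes, `θ₃ = θ`. [folklore] -/
theorem plain_reading_le {θ A C_G D G : ℝ} {k : ℕ} (hθ : 0 < θ) (hθ1 : θ ≤ 1) (hA : 0 ≤ A) (hCG : 0 ≤ C_G)
    (hD : D ≤ A * θ ^ (8 * k)) (hGr : G ≤ C_G * θ ^ (13 * k)) :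
    max (D / θ ^ (6 * k)) (G / θ ^ (12 * k)) ≤ (A + C_G) * θ ^ k := by
  have hθ6 : 0 < θ ^ (6 * k) := pow_pos hθ _
  have hθ12 : 0 < θ ^ (12 * k) := pow_pos hθ _
  have hθle : ∀ {i j : ℕ}, j ≤ i → θ ^ i ≤ θ ^ j := fun h => pow_le_pow_of_le_one hθ.le hθ1 h
  have e8 : θ ^ (8 * k) = θ ^ (2 * k) * θ ^ (6 * k) := by rw [← pow_add]; congr 1; ring
  have e13 : θ ^ (13 * k) = θ ^ k * θ ^ (12 * k) := by rw [← pow_add]; congr 1; ring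
  have h2k : θ ^ (2 * k) ≤ θ ^ k := hθle (by omega)
  refine max_le ?_ ?_
  · rw [div_le_iff₀ hθ6]
    calc D ≤ A * θ ^ (8 * k) := hD
      _ = A * θ ^ (2 * k) * θ ^ (6 * k) := by rw [e8]; ring
      _ ≤ A * θ ^ k * θ ^ (6 * k) := mul_le_mul_of_nonneg_right (mul_le_mul_of_nonneg_left h2k hA) hθ6.le
      _ ≤ (A + C_G) * θ ^ k * θ ^ (6 * k) := by gcongr; linarith
  · rw [div_le_iff₀ hθ12]
    calc G ≤ C_G * θ ^ (13 * k) := hGr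
      _ = C_G * θ ^ k * θ ^ (12 * k) := by rw [e13]; ring
      _ ≤ (A + C_G) * θ ^ k * θ ^ (12 * k) := by gcongr; linarith

/-! ## §3 Configurations: the letters at the rates of `closeness_of_covRoot₂`, and the END (`d = 4`) -/

/-- **THE PLAIN QUANTITIES AT RATE** (`d = 4`).  `W` unitary with smooth-gauge letters `‖W_b − 1‖ ≤ σ₀θ^{6k}`, `‖∇W‖ ≤ σ₁θ^{6k}` (`σ₀, σ₁ ≥ 0`);
`Z` with (P) `‖Z‖ ≤ 8l₁²γ·θ^{8k}` and (Gᶜ) `‖Ad (W (x+e κ) μ) (Z (x+e μ) κ) − Z x κ‖ ≤ 4l₁√(2γΛ₂′)·θ^{13k}`; `0 < θ ≤ 1`, `0 ≤ γ`, `8l₁²γ·θ^{8k} ≤ 1`.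
THEN (i) `‖(W e^Z)(b) − W(b)‖ ≤ 16l₁²γ·θ^{8k}`; (ii) the plain gradient of `W e^Z − W` is
`≤ (4l₁√(2γΛ₂′) + 16l₁²γ(σ₀ + σ₁) + 128l₁⁴γ²)·θ^{13k}`. [folklore] -/
theorem plain_letters_of_rates [Nonempty n] {W : Site 4 → Fin 4 → (Matrix n n ℂ)ˣ} (hW : IsUnitaryCfg W)
    {Z : Site 4 → Fin 4 → Matrix n n ℂ} {θ γ l₁ Λ₂' σ₀ σ₁ : ℝ} {k : ℕ} (hθ : 0 < θ) (hθ1 : θ ≤ 1) (hγ : 0 ≤ γ)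
    (hσ₀ : 0 ≤ σ₀) (hσ₁ : 0 ≤ σ₁) (hp1 : 8 * l₁ ^ 2 * γ * θ ^ (8 * k) ≤ 1)
    (hP : ∀ (x : Site 4) (κ : Fin 4), ‖Z x κ‖ ≤ 8 * l₁ ^ 2 * γ * θ ^ (8 * k))
    (hG : ∀ (x : Site 4) (μ κ : Fin 4),
      ‖Ad (W (x + e κ) μ) (Z (x + e μ) κ) - Z x κ‖ ≤ 4 * l₁ * Real.sqrt (2 * γ * Λ₂') * θ ^ (13 * k))
    (hs₀ : ∀ x κ, ‖((W x κ : (Matrix n n ℂ)ˣ) : Matrix n n ℂ) - 1‖ ≤ σ₀ * θ ^ (6 * k))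
    (hs₁ : ∀ x μ κ, ‖((W (x + e μ) κ : (Matrix n n ℂ)ˣ) : Matrix n n ℂ) - ((W x κ : (Matrix n n ℂ)ˣ) : Matrix n n ℂ)‖
      ≤ σ₁ * θ ^ (6 * k)) :
    (∀ (x : Site 4) (κ : Fin 4),
        ‖((vary W Z 1 x κ : (Matrix n n ℂ)ˣ) : Matrix n n ℂ) - ((W x κ : (Matrix n n ℂ)ˣ) : Matrix n n ℂ)‖
          ≤ 16 * l₁ ^ 2 * γ * θ ^ (8 * k)) ∧
    (∀ (x : Site 4) (μ κ : Fin 4),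
        ‖(((vary W Z 1 (x + e μ) κ : (Matrix n n ℂ)ˣ) : Matrix n n ℂ) - ((W (x + e μ) κ : (Matrix n n ℂ)ˣ) : Matrix n n ℂ))
            - (((vary W Z 1 x κ : (Matrix n n ℂ)ˣ) : Matrix n n ℂ) - ((W x κ : (Matrix n n ℂ)ˣ) : Matrix n n ℂ))‖
          ≤ (4 * l₁ * Real.sqrt (2 * γ * Λ₂') + 16 * l₁ ^ 2 * γ * (σ₀ + σ₁) + 128 * l₁ ^ 4 * γ ^ 2) * θ ^ (13 * k)) := by
  have ha : 0 ≤ 8 * l₁ ^ 2 * γ := by positivity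
  have hp0 : 0 ≤ 8 * l₁ ^ 2 * γ * θ ^ (8 * k) := mul_nonneg ha (pow_nonneg hθ.le _)
  have hx1 : 0 ≤ Real.exp (8 * l₁ ^ 2 * γ * θ ^ (8 * k)) - 1 := by
    linarith [Real.add_one_le_exp (8 * l₁ ^ 2 * γ * θ ^ (8 * k))]
  have e1 : 2 * (8 * l₁ ^ 2 * γ) = 16 * l₁ ^ 2 * γ := by ring
  have e2 : 4 * l₁ * Real.sqrt (2 * γ * Λ₂') + 2 * (8 * l₁ ^ 2 * γ) * (σ₀ + σ₁) + 2 * (8 * l₁ ^ 2 * γ) ^ 2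
      = 4 * l₁ * Real.sqrt (2 * γ * Λ₂') + 16 * l₁ ^ 2 * γ * (σ₀ + σ₁) + 128 * l₁ ^ 4 * γ ^ 2 := by ring
  refine ⟨fun x κ => ?_, fun x μ κ => ?_⟩
  · have h := (letters_at_rates (G := 0) (c := 4 * l₁ * Real.sqrt (2 * γ * Λ₂')) (σ₀ := σ₀) (σ₁ := σ₁) hθ hθ1 ha hσ₀ hσ₁
      rfl hp1 rfl (norm_plainSup_le hW hP x κ) ?_).1
    · rw [e1] at h; exact h
    · -- `0 ≤` the right-hand side (all letters nonnegative)
      have hq0 : 0 ≤ 4 * l₁ * Real.sqrt (2 * γ * Λ₂') * θ ^ (13 * k) := by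
        have := norm_nonneg (Ad (W (x + e κ) κ) (Z (x + e κ) κ) - Z x κ)
        linarith [hG x κ κ]
      have := expRem_nonneg (8 * l₁ ^ 2 * γ * θ ^ (8 * k))
      have hθ6 : 0 ≤ θ ^ (6 * k) := pow_nonneg hθ.le _
      positivity
  · have h := (letters_at_rates (D := 0) (c := 4 * l₁ * Real.sqrt (2 * γ * Λ₂')) hθ hθ1 ha hσ₀ hσ₁ rfl hp1 rfl ?_
      (norm_plainGrad_le hW hP (fun κ' x' μ' => hG x' μ' κ') hs₀ hs₁ x μ κ)).2
    · rw [e2] at h; exact h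
    · exact hx1

/-- **THE BACKGROUND COORDINATE IN THE PLAIN (EMBEDDING) READING, FROM THE COVARIANT ROOT + A SMOOTH GAUGE OF `W`** (`d = 4`).  Hypotheses of
`NE7EtaCurlFromCovGradient.closeness_of_covRoot₂` verbatim (the eight-conjunct covariant root `h` = row NE3's unseated estimate, amendment 4; class
data; budget `γ`; cube root `l₁`; fit `γ(θ^k)² ≤ l₁N`), plus `θ ≤ 1`, `8l₁²γθ^{8k} ≤ 1`, and TWO DISPLAYED SMOOTH-GAUGE LETTERS of the given
`W = rescale L (bavg L UB)`: `‖W_b − 1‖ ≤ σ₀θ^{6k}`, `‖∇W‖ ≤ σ₁θ^{6k}` (one-run, regular-gauge TYPE; asserted nowhere).  THEN `∃ u Z` with the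
representation `gaugeAct u UA = W e^Z` and the PLAIN letters an ambient-embedding carrier gauge reads:
(i) `‖(gaugeAct u UA)(b) − W(b)‖ ≤ 16l₁²γ·θ^{8k}`, (ii) plain gradient of `gaugeAct u UA − W` `≤ (4l₁√(2γΛ₂′) + 16l₁²γ(σ₀+σ₁) + 128l₁⁴γ²)·θ^{13k}`.
[folklore] -/
theorem plain_closeness_of_covRoot₂ [Nonempty n] {𝒞 : ℕ → Set (Site 4 → Fin 4 → (Matrix n n ℂ)ˣ)} {L N : ℕ} (hL : 2 ≤ L)
    (hN : 1 ≤ N) {θ : ℝ} (hθ : 0 < θ) (hθ1 : θ ≤ 1) (hθ6 : θ ^ 6 = ((L : ℝ))⁻¹) {b g C Λ₁ Λ₂' : ℝ} (hb : 0 ≤ b)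
    (hbs : 512 * (4 + 1) * (4 + 4) * (L : ℝ) ^ 2 * b ≤ 1) (hg : 0 ≤ g) (hC : 0 ≤ C) (hΛ₂' : 0 < Λ₂')
    {dom : Set (Site 4 → Fin 4 → (Matrix n n ℂ)ˣ)}
    (h : ∀ k : ℕ, 1 ≤ k → ∀ V ∈ dom, ∀ UA UB : Site 4 → Fin 4 → (Matrix n n ℂ)ˣ,
      IsMinimiser 4 𝒞 L N k V UA → IsMinimiser 4 𝒞 L N (k + 1) V UB → Regular 4 L N b g (k + 1) UB →
        ∃ (u : Site 4 → (Matrix n n ℂ)ˣ) (Z : Site 4 → Fin 4 → Matrix n n ℂ),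
          IsUnitarySite u ∧ IsPeriodicSite u ((N * L ^ k : ℕ) : ℤ) ∧
          IsSkewDir Z ∧ IsPeriodicDir Z ((N * L ^ k : ℕ) : ℤ) ∧
          gaugeAct u UA = vary (rescale L (bavg L UB)) Z 1 ∧
          energyNormW L k (rescale L (bavg L UB)) Z (periodBox (N * L ^ k)) ≤ C * residualScale 4 L N b g k ∧
          (∀ (κ : Fin 4) (x : Site 4) (μ : Fin 4),
            ‖Ad (rescale L (bavg L UB) (x + e κ) μ) (Z (x + e μ) κ) - Z x κ‖ ≤ Λ₁ * (((L : ℝ)⁻¹) ^ k) ^ 2) ∧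
          (∀ (κ μ : Fin 4) (y : Site 4),
            ‖Ad (rescale L (bavg L UB) (y + e κ) μ)
                (Ad (rescale L (bavg L UB) (y + e κ + e μ) μ) (Z (y + (2 : ℕ) • e μ) κ) - Z (y + e μ) κ)
              - (Ad (rescale L (bavg L UB) (y + e κ) μ) (Z (y + e μ) κ) - Z y κ)‖ ≤ Λ₂' * (((L : ℝ)⁻¹) ^ k) ^ 3))
    {γ l₁ : ℝ} (hγ : 0 < γ)
    (hγ3 : C * (wallConst 4 L * (N : ℝ) ^ 2 * (Real.sqrt g * dualC2 4 L + 2 * b ^ 2 * dualC1 4 L)) ≤ γ ^ 3)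
    (hl₁ : 0 < l₁) (hΛl₁ : Λ₁ ≤ l₁ ^ 3)
    {k : ℕ} (hk : 1 ≤ k) (hfit : γ * (θ ^ k) ^ 2 ≤ l₁ * N) (hp1 : 8 * l₁ ^ 2 * γ * θ ^ (8 * k) ≤ 1)
    {V : Site 4 → Fin 4 → (Matrix n n ℂ)ˣ} (hV : V ∈ dom) {UA UB : Site 4 → Fin 4 → (Matrix n n ℂ)ˣ}
    (hA : IsMinimiser 4 𝒞 L N k V UA) (hB : IsMinimiser 4 𝒞 L N (k + 1) V UB) (hreg : Regular 4 L N b g (k + 1) UB)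
    {σ₀ σ₁ : ℝ} (hσ₀ : 0 ≤ σ₀) (hσ₁ : 0 ≤ σ₁)
    (hs₀ : ∀ x κ, ‖((rescale L (bavg L UB) x κ : (Matrix n n ℂ)ˣ) : Matrix n n ℂ) - 1‖ ≤ σ₀ * θ ^ (6 * k))
    (hs₁ : ∀ x μ κ, ‖((rescale L (bavg L UB) (x + e μ) κ : (Matrix n n ℂ)ˣ) : Matrix n n ℂ)
        - ((rescale L (bavg L UB) x κ : (Matrix n n ℂ)ˣ) : Matrix n n ℂ)‖ ≤ σ₁ * θ ^ (6 * k)) :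
    ∃ (u : Site 4 → (Matrix n n ℂ)ˣ) (Z : Site 4 → Fin 4 → Matrix n n ℂ),
      IsUnitarySite u ∧ IsPeriodicSite u ((N * L ^ k : ℕ) : ℤ) ∧ IsSkewDir Z ∧ IsPeriodicDir Z ((N * L ^ k : ℕ) : ℤ) ∧
      gaugeAct u UA = vary (rescale L (bavg L UB)) Z 1 ∧
      (∀ (x : Site 4) (κ : Fin 4),
        ‖((gaugeAct u UA x κ : (Matrix n n ℂ)ˣ) : Matrix n n ℂ) - ((rescale L (bavg L UB) x κ : (Matrix n n ℂ)ˣ) : Matrix n n ℂ)‖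
          ≤ 16 * l₁ ^ 2 * γ * θ ^ (8 * k)) ∧
      (∀ (x : Site 4) (μ κ : Fin 4),
        ‖(((gaugeAct u UA (x + e μ) κ : (Matrix n n ℂ)ˣ) : Matrix n n ℂ)
              - ((rescale L (bavg L UB) (x + e μ) κ : (Matrix n n ℂ)ˣ) : Matrix n n ℂ))
            - (((gaugeAct u UA x κ : (Matrix n n ℂ)ˣ) : Matrix n n ℂ)
              - ((rescale L (bavg L UB) x κ : (Matrix n n ℂ)ˣ) : Matrix n n ℂ))‖
          ≤ (4 * l₁ * Real.sqrt (2 * γ * Λ₂') + 16 * l₁ ^ 2 * γ * (σ₀ + σ₁) + 128 * l₁ ^ 4 * γ ^ 2) * θ ^ (13 * k)) := by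
  obtain ⟨u, Z, hu, huP, hZ, hZP, hrep, hPr, hGr, -, -⟩ :=
    closeness_of_covRoot₂ hL hN hθ hθ6 hb hbs hg hC hΛ₂' h hγ hγ3 hl₁ hΛl₁ hk hfit hV hA hB hreg
  have hL1 : 1 ≤ L := by omega
  obtain ⟨hWu, -⟩ := unitary_periodic_rescale_bavg_of_regular hL1 hb hbs hreg
  obtain ⟨hsup, hgrad⟩ := plain_letters_of_rates hWu hθ hθ1 hγ.le hσ₀ hσ₁ hp1 hPr hGr hs₀ hs₁
  refine ⟨u, Z, hu, huP, hZ, hZP, hrep, ?_, ?_⟩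
  · intro x κ
    rw [hrep]
    exact hsup x κ
  · intro x μ κ
    rw [hrep]
    exact hgrad x μ κ

end

end Summit.QuantumFields.BalabanUV.T4Continuum.NE7EtaPlainGradientLetters
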